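/-
Copyright: the b2b-balaban T⁴-continuum CRUX team, row NE7b leaf lineage `t4-ne7b-formalise-leaf-06` (gen 152). Project licence.
-/
import Summits.QuantumFields.BalabanUV.T4Continuum.Spine.NE7b.WindowHessianFromThirdDerivReading
import Summits.QuantumFields.BalabanUV.T4Continuum.Spine.NE7b.ThirdDerivLocalTerms
import Summits.QuantumFields.BalabanUV.T4Continuum.Spine.NE7b.LocalTermsHessianNorm

/-!
# THE END OF THE READING ROAD FOR A SUM OF LOCAL TERMS, EVERY NUMBER INTENSIVE: `⟪·,A·⟫ + Σ_p Φ_p ∘ π_p` with `A` `σ`-coercive,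
# `Φ_p ∈ C³(U_p)` ONLY, supports of size `≤ s` and overlap `≤ d`, per-term `‖D²Φ_p‖ ≤ h` at the centre and `‖D³Φ_p‖ ≤ τ` on the window
# ⟹ the road's first-order letter ON the model window `L ∩ box(x₀, a)` with modulus `2σ − d·(h + s²·τ·a)` — the junction of
# `…WindowHessianFromThirdDerivReading` §4 (the `ContDiffOn` reading END), `…ThirdDerivLocalTerms` §5 (`c = d·s²·τ`) and
# `…LocalTermsHessianNorm` §3 (`‖D²P(x₀)‖ ≤ d·h`) (row NE7b, node U5c; letter (ℓ1) of the windowed road; junction, two `exact`s + `nlinarith`)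

Cell `pub-balaban`, sub-cell `t4`, spine estimate NE7b (`T4WeightBudget.RelWeightBound`; the cell's OWN estimate — NOT PRINTED in
[Bałaban 1983–89], NOT PROVED).  Crux-route work under `Spine/NE7b/` by a row leaf on the convexity road; NOTHING of Bałaban's is
named, valued or asserted; no `T4Continuum/Support` leaf typed; no `def`; zero `sorry`.  Imports: the three leaf-06 g152 files it joins.

WHAT IS PROVED ([folklore] junction): **`firstOrderOn_quadratic_add_localTerms_coordBox`** — on `E = EuclideanSpace ℝ (Fin n)`: `A` symmetric with
`σ‖v‖² ≤ ⟪v, Av⟫`; a linear subspace `L`, `x₀ ∈ L`, half-width `a ≥ 0`; terms `Φ_p : EuclideanSpace ℝ (S_p) → ℝ`, `ContDiffOn ℝ 3 (Φ_p) (U_p)` with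
`U_p` open, read through coordinate readings `π_p` of supports `S_p` (`|S_p| ≤ s`, every coordinate in `≤ d` supports), the box `box(x₀, a)` read into
every `U_p`; per-term letters `‖D²Φ_p(π_p x₀)‖ ≤ h_p ≤ h` (`0 ≤ h`) and `‖D³Φ_p(π_p z)‖ ≤ τ_p ≤ τ` on `L ∩ box(x₀, a)` (`0 ≤ τ_p`, `0 ≤ τ`) ⟹
for all `x, y ∈ L ∩ box(x₀, a)`:
`(⟪x,Ax⟫ + P x) + ⟪∇(⟪·,A·⟫ + P)(x), y − x⟫ + (2σ − d(h + s²τ·a))∕2 · ‖y − x‖² ≤ ⟪y,Ay⟫ + P y`, `P = Σ_p Φ_p ∘ π_p`.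
Displayed numbers: `σ, d, s, h, τ, a` — all LOCAL; `n` and the number of terms do not enter.

NOT HERE (honest): the per-term `h_p`, `τ_p` from print's analytic currency (`…AnalyticGradientLetter` `4M∕δ²`, `…AnalyticThirdDerivLetter` `27M∕δ³`
— two more `exact`s when their oleans exist), the numbers for Bałaban's steps and WHICH `A`, `Φ_p`, `S_p` ((A3) ∕ (A1c), NC-NE7b-α UNRULED);
R-AHL-g83-1 (c); anything of Bałaban's.  BY-NAME EFFECT ON THE WALL: NONE.  NE7b NOT PRINTED ∕ NOT PROVED; spine PROVED 0∕9; rung (B)+1 on a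
FINITE torus — NOT infinite volume, NOT the mass gap, NOT Clay.
HONEST DEPENDENCY: continuum YM on T⁴ ⇐ BetaPertH ∧ nine spine estimates (0/9 proved); BetaPertH ⇐ (D1) ∧ (D4) ∧ CAP+tail; G-an2-4 gates asym,
D1 and NE2∕3∕4.
-/

set_option autoImplicit false

noncomputable section

open Set Finset
open scoped RealInnerProductSpace Gradient
open Summit.QuantumFields.BalabanUV.T4Continuum.NE7b.ConvexWindowSuppliersBox
open Summit.QuantumFields.BalabanUV.T4Continuum.NE7b.WindowHessianFromThirdDerivReading
open Summit.QuantumFields.BalabanUV.T4Continuum.NE7b.ThirdDerivLocalTerms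
open Summit.QuantumFields.BalabanUV.T4Continuum.NE7b.LocalTermsHessianNorm

namespace Summit.QuantumFields.BalabanUV.T4Continuum.NE7b.LocalTermsWindowEnd

variable {n : ℕ} {𝔓 : Type*} [Fintype 𝔓]

/-- **THE READING ROAD's END FOR A SUM OF LOCAL `C³(U_p)` TERMS ON THE MODEL WINDOW, EVERY NUMBER INTENSIVE**: modulus
`2σ − d·(h + s²·τ·a)` on `L ∩ box(x₀, a)` from the six local numbers `σ, d, s, h, τ, a` (see the module docstring). [folklore] junction -/
theorem firstOrderOn_quadratic_add_localTerms_coordBox (A : EuclideanSpace ℝ (Fin n) →L[ℝ] EuclideanSpace ℝ (Fin n))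
    (hA : ∀ v w : EuclideanSpace ℝ (Fin n), ⟪A v, w⟫ = ⟪v, A w⟫) {σ : ℝ} (hσ : ∀ v : EuclideanSpace ℝ (Fin n), σ * ‖v‖ ^ 2 ≤ ⟪v, A v⟫)
    (L : Submodule ℝ (EuclideanSpace ℝ (Fin n))) {x₀ : EuclideanSpace ℝ (Fin n)} (hx₀ : x₀ ∈ L) {a : ℝ} (ha : 0 ≤ a)
    (S : 𝔓 → Finset (Fin n)) (π : (p : 𝔓) → (EuclideanSpace ℝ (Fin n) →L[ℝ] EuclideanSpace ℝ (S p)))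
    (hπ : ∀ p (v : EuclideanSpace ℝ (Fin n)) (i : S p), π p v i = v i) (Φ : (p : 𝔓) → EuclideanSpace ℝ (S p) → ℝ)
    (U : (p : 𝔓) → Set (EuclideanSpace ℝ (S p))) (hU : ∀ p, IsOpen (U p)) (hΦ : ∀ p, ContDiffOn ℝ 3 (Φ p) (U p))
    (hbox : ∀ z ∈ {x : EuclideanSpace ℝ (Fin n) | ∀ i : Fin n, |x i - x₀ i| ≤ a}, ∀ p, π p z ∈ U p)
    {smax : ℝ} {d : ℕ} (hs : ∀ p, ((S p).card : ℝ) ≤ smax) (hd : ∀ i : Fin n, (univ.filter (fun p => i ∈ S p)).card ≤ d)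
    (hterm : 𝔓 → ℝ) {h : ℝ} (hh0 : 0 ≤ h) (hle : ∀ p, hterm p ≤ h) (hH : ∀ p, ‖iteratedFDeriv ℝ 2 (Φ p) (π p x₀)‖ ≤ hterm p)
    (τ : 𝔓 → ℝ) (hτ0 : ∀ p, 0 ≤ τ p) {τmax : ℝ} (hτmax0 : 0 ≤ τmax) (hτmax : ∀ p, τ p ≤ τmax)
    (hτ : ∀ z ∈ (L : Set (EuclideanSpace ℝ (Fin n))) ∩ {x | ∀ i : Fin n, |x i - x₀ i| ≤ a},
      ∀ p, ‖iteratedFDeriv ℝ 3 (Φ p) (π p z)‖ ≤ τ p) :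
    ∀ x ∈ (L : Set (EuclideanSpace ℝ (Fin n))) ∩ {x | ∀ i : Fin n, |x i - x₀ i| ≤ a},
      ∀ y ∈ (L : Set (EuclideanSpace ℝ (Fin n))) ∩ {x | ∀ i : Fin n, |x i - x₀ i| ≤ a},
        (⟪x, A x⟫ + ∑ p, Φ p (π p x)) +
            ⟪gradient (fun z : EuclideanSpace ℝ (Fin n) => ⟪z, A z⟫ + ∑ p, Φ p (π p z)) x, y - x⟫ +
          (2 * σ - d * (h + smax ^ 2 * τmax * a)) / 2 * ‖y - x‖ ^ 2 ≤ ⟪y, A y⟫ + ∑ p, Φ p (π p y) := by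
  intro x hx y hy
  set K : Set (EuclideanSpace ℝ (Fin n)) := (L : Set (EuclideanSpace ℝ (Fin n))) ∩ {x | ∀ i : Fin n, |x i - x₀ i| ≤ a} with hKdef
  have hdom := contDiffOn_three_localTerms S π Φ U hU hΦ
  have hKU : K ⊆ {z : EuclideanSpace ℝ (Fin n) | ∀ p, π p z ∈ U p} := fun z hz => hbox z hz.2
  have hK : Convex ℝ K := (L.convex).inter (convex_coordBox x₀ a)
  have h0 : x₀ ∈ K := ⟨hx₀, fun i => by simpa using ha⟩
  have hKρ : ∀ z ∈ K, ‖WithLp.ofLp (z - x₀)‖ ≤ a := fun z hz => supNorm_sub_le_of_mem_coordBox ha hz.2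
  -- the reading letter with `c = d·s²·τ` (TDLT §5) and the reading END (WHTDR §4)
  have hread := thirdDeriv_supNorm_of_localTerms S π hπ Φ U hU hΦ (K := K) (fun z hz p => hKU hz p) τ hτ0 hτ hτmax0 hτmax hs hd
  have hend := firstOrderOn_quadratic_add_of_thirdDerivReadingOn A (fun w => ‖WithLp.ofLp w‖) hdom.1 hKU hK h0 hKρ hA hσ hdom.2
    (by positivity) hread x hx y hy
  -- the centre's Hessian norm is intensive (LTHN §3), from `C³ ⊆ C²`
  have hnorm : ‖iteratedFDeriv ℝ 2 (fun z => ∑ p, Φ p (π p z)) x₀‖ ≤ (d : ℝ) * h :=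
    norm_iteratedFDeriv_two_localTerms_le S π hπ hd Φ U hU (fun p => (hΦ p).of_le (by norm_num)) (hKU h0) hterm hh0 hle hH
  nlinarith [hend, hnorm, sq_nonneg ‖y - x‖]

end Summit.QuantumFields.BalabanUV.T4Continuum.NE7b.LocalTermsWindowEnd

end
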